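import Summits.QuantumAdvantage.AdviceFreeQNC0.OneSidedWindowPointwise
import Summits.QuantumAdvantage.AdviceFreeQNC0.InducedStrategy
import Summits.QuantumAdvantage.AdviceFreeQNC0.LowDegreeGapStrategies
import HarnessLib

/-!
# Cell qa-qnc0 (rung F-Q1, route RingFrame, crux α `RingToElim`): K-FEATURE WINDOWS (planner
# qa-qnc0-p1's THEOREM-TARGET T9, Sketch11 §23.5 `KFeatureWindowSqrt`, VERBATIM)

**T9** (`kFeatureWindowSqrt : KFeatureWindowSqrt`).  Window `a(p) ++ x(L) ++ h(H) ++ z(M) ++ b(q)`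
of a walk strategy of degree `≤ D ≤ c₁√M`; on each fibre `(a, h, b)` the cuts strictly inside the
`z`-block read the `x`-block only through `K` Boolean FEATURES `φ_k` of degree `≤ D` (which may
depend on the fibre), with the PLDAMS budget `K·D ≤ c₁√L`.  Then the strategy wins on at most
`θ·2ⁿ` inputs, `θ = 1 − κ₀η₀ < 1` (`κ₀` = the PLDAMS constant of `pldamsBool_sqrt`, `η₀` = the
two-bit elimination constant).  `K = 0` is the two-blind-spots theorem T8 (for `L ≥ n₀`);
`K = (M−1)·#Ball(M, D)` with the `z`-coefficients as features is THEOREM V's atom partition; the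
fence `PLDAMSFence*.lean` shows the budget `K·D ≲ √L` is the end of this road.

Proof.  By the pointwise one-sided identity (`exists_elimWin_oneSided`,
`OneSidedWindowPointwise.lean`), on the fibre `WIN(x, z) = e_x(z) ⊕ B^x_{2|x|}(z)` with `e_x` an
elimination win pattern of degree `≤ D` and `B^x` the interior pattern of the slice of `x`
(`interiorPat`: `3`-periodic, even, and — by the feature hypothesis — constant on the ATOMS
`{x : (φ_k x)_k = α}`, `interiorPat_congr`).  Row `x` loses `≥ distFail_D(B^x_{2|x|})`; on an atom
`A_α` the three offsets `2|x| mod 3` each carry `≥ κ₀·#A_α` rows (PLDAMS `pldamsBool_sqrt` for the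
atom indicator, of degree `≤ K·D ≤ c√L` by `hasDeg_forall_deg`), so the atom loses
`≥ κ₀·#A_α·(Σ_r distFail_D(B^α_r)) ≥ κ₀·#A_α·distFail_D(0)` (`potential_cost`); summing,
`#LOSS ≥ κ₀·η₀·2ⁿ` (`le_distFail_zero_of`, `elimSqrtDec_of_lowDegAvoidMod3Sparse`).

The cell's theorem (planner qa-qnc0-p1 gen 11, statement; prover qn-prover-3 gen 4, proof),
2026-08-27; not in print.  WHAT THIS IS NOT: nothing beyond the atom method (α proper needs
`K·D ≫ √L`); no separation.

## References

* S. Srinivasan, *A robust version of Hegedűs's lemma, with applications*, TheoretiCS 2 (2023),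
  Lemma 3.1 [Srinivasan2023] (through `lowDegAvoidMod3Sparse` and `pldamsSqrt`).
-/

noncomputable section

namespace Summit.QuantumAdvantage.AdviceFreeQNC0

open Finset
open Literature.Computability.MetaComplexity Literature.Computability.MetaComplexity.Smolensky

/-! ### Sketch11 §23.5, verbatim -/

/-- **T9, √-form** (planner qa-qnc0-p1, `Sketch11` §23.5, verbatim).  Window as in
`TwoBlindSpotsSqrt`, but now the cuts strictly inside `z` MAY read `x` — on each fibre (outside
bits `a, h, b` fixed) only through `K` Boolean features `φ k` of `x` of degree `≤ D` (features may
depend on the fibre; shared by all interior cuts and all `z`), with the PLDAMS budget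
`K·D ≤ c₁√L` on the `x`-block. -/
def KFeatureWindowSqrt : Prop :=
  ∃ θ : ℝ, θ < 1 ∧ ∃ c₁ : ℝ, 0 < c₁ ∧ ∃ n₀ : ℕ, ∀ p L H M q K : ℕ, n₀ ≤ L → n₀ ≤ M →
    ∀ D : ℕ, (D : ℝ) ≤ c₁ * Real.sqrt M → ((K * D : ℕ) : ℝ) ≤ c₁ * Real.sqrt L →
    ∀ (c : ℕ) (y : Fin (p + (L + H + M) + q + 1) → (Fin (p + (L + H + M) + q) → Bool) → Bool),
      (∀ g, HasDeg (y g) D) →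
      (∀ (a : Fin p → Bool) (h : Fin H → Bool) (b : Fin q → Bool),
        ∃ φ : Fin K → (Fin L → Bool) → Bool, (∀ k, HasDeg (φ k) D) ∧
          ∀ g : Fin (p + (L + H + M) + q + 1), p + (L + H) < g.val → g.val < p + (L + H + M) →
            ∀ (x x' : Fin L → Bool) (z : Fin M → Bool), (∀ k, φ k x = φ k x') →
              y g (glue3 a (glue3 x h z) b) = y g (glue3 a (glue3 x' h z) b)) →
      ((univ.filter fun u : Fin (p + (L + H + M) + q) → Bool => ringWinU c y u = true).card : ℝ) ≤
        θ * (2 : ℝ) ^ (p + (L + H + M) + q)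

/-! ### Tools -/

variable {L H M : ℕ}

/-- Fubini for the window: a count over `{0,1}^{L+H+M}` is the iterated count over `h`, `x`, `z`. -/
private theorem card_filter_window_eq_sum' (Q : (Fin (L + H + M) → Bool) → Prop) [DecidablePred Q] :
    (univ.filter fun v : Fin (L + H + M) → Bool => Q v).card =
      ∑ h : Fin H → Bool, ∑ x : Fin L → Bool,
        (univ.filter fun z : Fin M → Bool => Q (glue3 x h z)).card := by
  rw [card_filter_eq_sum_glue3]
  have hx : ∀ x : Fin L → Bool, ∑ z : Fin M → Bool,
      (univ.filter fun h : Fin H → Bool => Q (glue3 x h z)).card =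
      ∑ h : Fin H → Bool, (univ.filter fun z : Fin M → Bool => Q (glue3 x h z)).card := by
    intro x
    simp only [Finset.card_filter]
    rw [Finset.sum_comm]
  rw [Finset.sum_congr rfl fun x _ => hx x, Finset.sum_comm]

/-- A split `W = e ⊕ B` with `e` an elimination win pattern loses at least `distFail_D(B)`. -/
private theorem distFail_le_loss_of_win_split {D : ℕ} {e B W : (Fin M → Bool) → Bool}
    (he : IsElimWin D e) (hW : ∀ z, W z = xor (e z) (B z)) :
    distFail D B ≤ (univ.filter fun z : Fin M → Bool => W z = false).card := by
  obtain ⟨c₀, a, b, ha, hb, hfe⟩ := he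
  have hF : IsElimFail D (elimFail c₀ a b) := ⟨c₀, a, b, ha, hb, fun _ => rfl⟩
  refine le_trans (distFail_le B hF) (le_of_eq (congrArg Finset.card (Finset.filter_congr ?_)))
  intro z _
  rw [hW z, hfe z]
  cases elimFail c₀ a b z <;> cases B z <;> decide

/-- Regrouping a sum of `f (s x mod 3)` by the residue. -/
private theorem sum_regroup3 {X : Type*} (S : Finset X) (s : X → ℕ) (f : ℕ → ℕ) :
    ∑ x ∈ S, f (s x % 3) =
      (S.filter fun x => s x % 3 = 0).card * f 0 + (S.filter fun x => s x % 3 = 1).card * f 1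
        + (S.filter fun x => s x % 3 = 2).card * f 2 := by
  classical
  have h1 : ∀ x ∈ S, f (s x % 3) = ∑ r ∈ range 3, (if s x % 3 = r then f r else 0) := by
    intro x _
    rw [Finset.sum_ite_eq (range 3) (s x % 3) (fun r => f r),
      if_pos (Finset.mem_range.2 (Nat.mod_lt _ (by norm_num)))]
  rw [Finset.sum_congr rfl h1, Finset.sum_comm]
  have h2 : ∀ r, ∑ x ∈ S, (if s x % 3 = r then f r else 0) = (S.filter fun x => s x % 3 = r).card * f r := by
    intro r
    rw [Finset.card_filter, Finset.sum_mul]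
    refine Finset.sum_congr rfl fun x _ => ?_
    by_cases hx : s x % 3 = r <;> simp [hx]
  simp only [h2, Finset.sum_range_succ, Finset.sum_range_zero, zero_add]

/-- **The atom step.**  On a set `S` of rows each of whose three offset classes holds at least a
`κ₀`-fraction of `S`, an even triple of potential costs `f 0, f 1, f 2 ≥ dF` in total gives
`Σ_{x ∈ S} f (s x mod 3) ≥ κ₀·#S·dF`. -/
private theorem atom_step {X : Type*} {κ₀ : ℝ} (hκ₀ : 0 ≤ κ₀) (S : Finset X) (s : X → ℕ)
    (f : ℕ → ℕ) (dF : ℕ) (hpc : dF ≤ f 0 + f 1 + f 2)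
    (hP : ∀ r, r < 3 → κ₀ * (S.card : ℝ) ≤ ((S.filter fun x => s x % 3 = r).card : ℝ)) :
    κ₀ * (S.card : ℝ) * (dF : ℝ) ≤ ((∑ x ∈ S, f (s x % 3) : ℕ) : ℝ) := by
  rw [sum_regroup3 S s f]
  push_cast
  have h0 := hP 0 (by norm_num)
  have h1 := hP 1 (by norm_num)
  have h2 := hP 2 (by norm_num)
  have hpc' : (dF : ℝ) ≤ (f 0 : ℝ) + (f 1 : ℝ) + (f 2 : ℝ) := by exact_mod_cast hpc
  have hf0 : (0 : ℝ) ≤ f 0 := Nat.cast_nonneg _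
  have hf1 : (0 : ℝ) ≤ f 1 := Nat.cast_nonneg _
  have hf2 : (0 : ℝ) ≤ f 2 := Nat.cast_nonneg _
  have hS : (0 : ℝ) ≤ κ₀ * (S.card : ℝ) := mul_nonneg hκ₀ (Nat.cast_nonneg _)
  calc κ₀ * (S.card : ℝ) * (dF : ℝ) ≤ κ₀ * (S.card : ℝ) * ((f 0 : ℝ) + f 1 + f 2) :=
        mul_le_mul_of_nonneg_left hpc' hS
    _ = κ₀ * (S.card : ℝ) * f 0 + κ₀ * (S.card : ℝ) * f 1 + κ₀ * (S.card : ℝ) * f 2 := by ring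
    _ ≤ ((S.filter fun x => s x % 3 = 0).card : ℝ) * f 0
        + ((S.filter fun x => s x % 3 = 1).card : ℝ) * f 1
        + ((S.filter fun x => s x % 3 = 2).card : ℝ) * f 2 :=
        add_le_add (add_le_add (mul_le_mul_of_nonneg_right h0 hf0) (mul_le_mul_of_nonneg_right h1 hf1))
          (mul_le_mul_of_nonneg_right h2 hf2)

/-! ### The theorem -/

/-- **`KFeatureWindowSqrt` holds (T9).** [cite: Srinivasan2023, Lemma 3.1] -/
theorem kFeatureWindowSqrt : KFeatureWindowSqrt := by
  classical
  obtain ⟨η₀, hη₀, c₀, hc₀, ℓ₀, H⟩ := elimSqrtDec_of_lowDegAvoidMod3Sparse lowDegAvoidMod3Sparse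
  obtain ⟨κ₀, hκ₀, cP, hcP, n₁, HP⟩ := pldamsBool_sqrt
  refine ⟨1 - κ₀ * η₀, by nlinarith [mul_pos hκ₀ hη₀], min cP c₀, lt_min hcP hc₀, max ℓ₀ n₁, ?_⟩
  intro p L Hm M q K hL hM D hD hKD c y hdeg hφ
  have hℓ₀M : ℓ₀ ≤ M := le_trans (le_max_left _ _) hM
  have hn₁L : n₁ ≤ L := le_trans (le_max_right _ _) hL
  have hD' : (D : ℝ) ≤ c₀ * Real.sqrt M :=
    le_trans hD (mul_le_mul_of_nonneg_right (min_le_right _ _) (Real.sqrt_nonneg _))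
  have hKD' : D * K ≤ ⌊cP * Real.sqrt L⌋₊ := by
    rw [Nat.mul_comm]
    refine Nat.le_floor (le_trans hKD ?_)
    exact mul_le_mul_of_nonneg_right (min_le_left _ _) (Real.sqrt_nonneg _)
  -- elimination hardness on the block
  have hdF : η₀ * (2 : ℝ) ^ M ≤ (distFail D (fun _ : Fin M → Bool => false) : ℝ) :=
    le_distFail_zero_of fun a b ha hb dec => H M hℓ₀M D hD' a b ha hb dec
  -- the loss on each fibre `(a, h, b)`
  have hfib : ∀ (a : Fin p → Bool) (h : Fin Hm → Bool) (b : Fin q → Bool),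
      κ₀ * (2 : ℝ) ^ L * (distFail D (fun _ : Fin M → Bool => false) : ℝ) ≤
        ((∑ x : Fin L → Bool, (univ.filter fun z : Fin M → Bool =>
          ringWinU c y (glue3 a (glue3 x h z) b) = false).card : ℕ) : ℝ) := by
    intro a h b
    obtain ⟨φ, hφdeg, hφ'⟩ := hφ a h b
    -- the feature map and its atoms
    set Ψ : (Fin L → Bool) → (Fin K → Bool) := fun x k => φ k x with hΨ
    have hatom : ∀ α : Fin K → Bool,
        HasDeg (fun x : Fin L → Bool => decide (Ψ x = α)) (⌊cP * Real.sqrt L⌋₊) := by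
      intro α
      refine hasDeg_of_le ?_ hKD'
      have h := hasDeg_forall_deg (univ : Finset (Fin K)) (fun k (x : Fin L → Bool) =>
          decide (φ k x = α k)) D (fun k _ => hasDeg_decide_eq (hφdeg k) (α k))
        (G := fun x : Fin L → Bool => decide (Ψ x = α)) (fun x => by
          rw [decide_eq_true_iff]
          constructor
          · intro hx k _; rw [decide_eq_true_iff, ← hx]
          · intro hx; funext k; exact (decide_eq_true_iff.1 (hx k (Finset.mem_univ k))))
      rwa [Finset.card_univ, Fintype.card_fin] at h
    -- the interior pattern is constant on atoms
    have hcongr : ∀ x x' : Fin L → Bool, Ψ x = Ψ x' → ∀ s z,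
        interiorPat c y a h b x s z = interiorPat c y a h b x' s z := by
      intro x x' hxx' s z
      refine interiorPat_congr c y a h b (fun g h1 h2 z => hφ' g h1 h2 x x' z fun k => ?_) s z
      exact congrFun hxx' k
    -- each row loses at least the potential cost of its interior pattern
    have hrow : ∀ x : Fin L → Bool,
        distFail D (interiorPat c y a h b x ((2 * wt x) % 3)) ≤
          (univ.filter fun z : Fin M → Bool => ringWinU c y (glue3 a (glue3 x h z) b) = false).card := by
      intro x
      obtain ⟨e, he, hident⟩ := exists_elimWin_oneSided c y hdeg a h b x
      have hmod : interiorPat c y a h b x ((2 * wt x) % 3) = interiorPat c y a h b x (2 * wt x) := by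
        funext z; exact (interiorPat_mod c y a h b x (2 * wt x) z).symm
      rw [hmod]
      exact distFail_le_loss_of_win_split he hident
    -- sum the rows atom by atom
    set T : Finset (Fin K → Bool) := (univ : Finset (Fin L → Bool)).image Ψ with hT
    have hsum : (∑ x : Fin L → Bool, distFail D (interiorPat c y a h b x ((2 * wt x) % 3))) =
        ∑ α ∈ T, ∑ x ∈ univ.filter (fun x : Fin L → Bool => Ψ x = α),
          distFail D (interiorPat c y a h b x ((2 * wt x) % 3)) :=
      (Finset.sum_fiberwise_of_maps_to (fun x hx => Finset.mem_image_of_mem Ψ hx) _).symm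
    have hcardsum : ((2 : ℝ) ^ L) = ∑ α ∈ T, ((univ.filter fun x : Fin L → Bool => Ψ x = α).card : ℝ) := by
      have h := (Finset.sum_fiberwise_of_maps_to (s := (univ : Finset (Fin L → Bool))) (t := T)
        (g := Ψ) (fun x hx => Finset.mem_image_of_mem Ψ hx) (fun _ => (1 : ℝ))).symm
      simp only [Finset.sum_const, Finset.card_univ, Fintype.card_fun, Fintype.card_bool,
        Fintype.card_fin, nsmul_eq_mul, mul_one] at h
      exact_mod_cast h
    -- the atom step
    have hatomstep : ∀ α ∈ T,
        κ₀ * ((univ.filter fun x : Fin L → Bool => Ψ x = α).card : ℝ) *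
            (distFail D (fun _ : Fin M → Bool => false) : ℝ) ≤
          ((∑ x ∈ univ.filter (fun x : Fin L → Bool => Ψ x = α),
            distFail D (interiorPat c y a h b x ((2 * wt x) % 3)) : ℕ) : ℝ) := by
      intro α hα
      obtain ⟨x₀, -, hx₀⟩ := Finset.mem_image.1 hα
      set S := univ.filter (fun x : Fin L → Bool => Ψ x = α) with hS
      -- on the atom, the pattern is that of the representative
      have hrep : ∀ x ∈ S, distFail D (interiorPat c y a h b x ((2 * wt x) % 3)) =
          distFail D (interiorPat c y a h b x₀ ((2 * wt x) % 3)) := by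
        intro x hx
        have hxα : Ψ x = α := (Finset.mem_filter.1 hx).2
        congr 1
        funext z
        exact hcongr x x₀ (hxα.trans hx₀.symm) _ z
      rw [Finset.sum_congr rfl hrep]
      -- PLDAMS on the atom
      have hP : ∀ r, r < 3 → κ₀ * (S.card : ℝ) ≤ ((S.filter fun x => 2 * wt x % 3 = r).card : ℝ) := by
        intro r hr
        have h := HP L hn₁L (fun x => decide (Ψ x = α)) (hatom α) (2 * r)
        have e1 : (univ.filter fun x : Fin L → Bool => decide (Ψ x = α) = true) = S :=
          Finset.filter_congr fun x _ => by rw [decide_eq_true_iff]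
        have e2 : (univ.filter fun x : Fin L → Bool => decide (Ψ x = α) = true ∧ wt x % 3 = 2 * r % 3) =
            S.filter fun x => 2 * wt x % 3 = r := by
          rw [hS, Finset.filter_filter]
          refine Finset.filter_congr fun x _ => ?_
          rw [decide_eq_true_iff]
          constructor
          · rintro ⟨h1, h2⟩; exact ⟨h1, by omega⟩
          · rintro ⟨h1, h2⟩; exact ⟨h1, by omega⟩
        rw [e1, e2] at h
        exact h
      refine atom_step hκ₀.le S (fun x => 2 * wt x) (fun r => distFail D (interiorPat c y a h b x₀ r))
        _ ?_ hP
      -- the even triple of the representative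
      refine potential_cost D _ _ _ fun z => ?_
      have h := interiorPat_even c y a h b x₀ 0 z
      rw [Nat.zero_add, Nat.zero_add] at h
      rw [Bool.xor_assoc]
      exact h
    -- assemble the fibre bound
    have hrows : ((∑ x : Fin L → Bool, distFail D (interiorPat c y a h b x ((2 * wt x) % 3)) : ℕ) : ℝ)
        ≤ ((∑ x : Fin L → Bool, (univ.filter fun z : Fin M → Bool =>
          ringWinU c y (glue3 a (glue3 x h z) b) = false).card : ℕ) : ℝ) := by
      exact_mod_cast Finset.sum_le_sum fun x _ => hrow x
    refine le_trans ?_ hrows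
    rw [hsum]
    push_cast
    calc κ₀ * (2 : ℝ) ^ L * (distFail D (fun _ : Fin M → Bool => false) : ℝ)
        = ∑ α ∈ T, κ₀ * ((univ.filter fun x : Fin L → Bool => Ψ x = α).card : ℝ) *
            (distFail D (fun _ : Fin M → Bool => false) : ℝ) := by
          rw [hcardsum, Finset.mul_sum, Finset.sum_mul]
      _ ≤ ∑ α ∈ T, ((∑ x ∈ univ.filter (fun x : Fin L → Bool => Ψ x = α),
            distFail D (interiorPat c y a h b x ((2 * wt x) % 3)) : ℕ) : ℝ) :=
          Finset.sum_le_sum hatomstep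
      _ = _ := by push_cast; rfl
  -- total loss
  have hLsum : (univ.filter fun u : Fin (p + (L + Hm + M) + q) → Bool => ringWinU c y u = false).card =
      ∑ a : Fin p → Bool, ∑ b : Fin q → Bool, ∑ h : Fin Hm → Bool,
        ∑ x : Fin L → Bool, (univ.filter fun z : Fin M → Bool =>
          ringWinU c y (glue3 a (glue3 x h z) b) = false).card := by
    rw [card_filter_eq_sum_glue3]
    refine Finset.sum_congr rfl fun a _ => Finset.sum_congr rfl fun b _ => ?_
    exact card_filter_window_eq_sum' (fun v => ringWinU c y (glue3 a v b) = false)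
  have hconst : ∀ (α : Type) [Fintype α] (t : ℝ), ∑ _i : α, t = (Fintype.card α : ℝ) * t := by
    intro α _ t
    rw [Finset.sum_const, Finset.card_univ, nsmul_eq_mul]
  have hp : (Fintype.card (Fin p → Bool) : ℝ) = (2 : ℝ) ^ p := by
    rw [Fintype.card_fun, Fintype.card_bool, Fintype.card_fin]; push_cast; ring
  have hq : (Fintype.card (Fin q → Bool) : ℝ) = (2 : ℝ) ^ q := by
    rw [Fintype.card_fun, Fintype.card_bool, Fintype.card_fin]; push_cast; ring
  have hH : (Fintype.card (Fin Hm → Bool) : ℝ) = (2 : ℝ) ^ Hm := by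
    rw [Fintype.card_fun, Fintype.card_bool, Fintype.card_fin]; push_cast; ring
  have h4 : (2 : ℝ) ^ p * ((2 : ℝ) ^ q * ((2 : ℝ) ^ Hm *
      (κ₀ * (2 : ℝ) ^ L * (distFail D (fun _ : Fin M → Bool => false) : ℝ)))) ≤
      ((univ.filter fun u : Fin (p + (L + Hm + M) + q) → Bool => ringWinU c y u = false).card : ℝ) := by
    rw [hLsum]
    push_cast
    rw [← hp, ← hconst]
    refine Finset.sum_le_sum fun a _ => ?_
    rw [← hq, ← hconst]
    refine Finset.sum_le_sum fun b _ => ?_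
    rw [← hH, ← hconst]
    refine Finset.sum_le_sum fun h _ => ?_
    have h' := hfib a h b
    push_cast at h'
    exact h'
  -- wins and losses
  have htot : (univ.filter fun u : Fin (p + (L + Hm + M) + q) → Bool => ringWinU c y u = true).card +
      (univ.filter fun u : Fin (p + (L + Hm + M) + q) → Bool => ringWinU c y u = false).card =
      2 ^ (p + (L + Hm + M) + q) := by
    have h := Finset.card_filter_add_card_filter_not
      (s := (univ : Finset (Fin (p + (L + Hm + M) + q) → Bool))) (fun u => ringWinU c y u = true)
    have hneg : (univ.filter fun u : Fin (p + (L + Hm + M) + q) → Bool => ¬ ringWinU c y u = true) =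
        univ.filter fun u : Fin (p + (L + Hm + M) + q) → Bool => ringWinU c y u = false :=
      Finset.filter_congr fun u _ => by simp
    rw [hneg, Finset.card_univ, Fintype.card_fun, Fintype.card_bool, Fintype.card_fin] at h
    exact h
  have htotR : ((univ.filter fun u : Fin (p + (L + Hm + M) + q) → Bool => ringWinU c y u = true).card : ℝ)
      + ((univ.filter fun u : Fin (p + (L + Hm + M) + q) → Bool => ringWinU c y u = false).card : ℝ) =
      (2 : ℝ) ^ (p + (L + Hm + M) + q) := by exact_mod_cast htot
  have hpow : (2 : ℝ) ^ (p + (L + Hm + M) + q) =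
      (2 : ℝ) ^ p * ((2 : ℝ) ^ q * ((2 : ℝ) ^ Hm * ((2 : ℝ) ^ L * (2 : ℝ) ^ M))) := by
    rw [← pow_add, ← pow_add, ← pow_add, ← pow_add]; congr 1; omega
  have key : κ₀ * η₀ * (2 : ℝ) ^ (p + (L + Hm + M) + q) ≤
      ((univ.filter fun u : Fin (p + (L + Hm + M) + q) → Bool => ringWinU c y u = false).card : ℝ) := by
    calc κ₀ * η₀ * (2 : ℝ) ^ (p + (L + Hm + M) + q)
        = (2 : ℝ) ^ p * ((2 : ℝ) ^ q * ((2 : ℝ) ^ Hm * (κ₀ * (2 : ℝ) ^ L * (η₀ * (2 : ℝ) ^ M)))) := by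
          rw [hpow]; ring
      _ ≤ (2 : ℝ) ^ p * ((2 : ℝ) ^ q * ((2 : ℝ) ^ Hm *
          (κ₀ * (2 : ℝ) ^ L * (distFail D (fun _ : Fin M → Bool => false) : ℝ)))) := by
          have hκL : (0 : ℝ) ≤ κ₀ * (2 : ℝ) ^ L := by positivity
          gcongr
      _ ≤ _ := h4
  linarith

end Summit.QuantumAdvantage.AdviceFreeQNC0
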